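import Mathlib
import HarnessLib
import Summits.Parity.BatemanHorn.Theses.AlmostPrimeZeros
import Summits.Parity.BatemanHorn.Theorems.AlmostPrimeZerosSystemZeroRepulsionEulerSpeciesBound
import Summits.Parity.BatemanHorn.Theorems.AlmostPrimeZerosSystemZeroRepulsionFarZoneWide

/-!
# Line `buchstab-flow-hyperbolicity` — skeleton for crux `AlmostPrimeZeros.SystemZeroRepulsion` (stmt-Parity-11291)

RESHAPED v1 by the third line lead (prover-line-stmt-Parity-11291-c1-0, 2026-08-16): (i) the two stubs this line shares with
the other lines are CLOSED FROM THE TREE instead of being re-registered — `EulerSpeciesBound` is seat b's landed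
`…EulerSpeciesFactorisation.stub_eulerSpeciesBound` (p91899) verbatim after unfolding (`eulerSpeciesBound_holds`), and
`FarZone` follows from the shared far-moment stub S1′ through seat a's landed `…SmoothRoughLatticeAcquisition.
stub_farZone_of_farMomentWide` (p86487) (`farZone_of_farMomentWide`); (ii) the far-zone debt is therefore registered as
S1′ `stub_farMomentWide` VERBATIM (one shared anatomy stub across all three lines; proved for `k ≤ 1` linear systems,
`stub_farMomentWide_linear`); (iii) `stub_longCyclesLattice` carries its signature INLINE (no skeleton-local def) so that
a Theorems file can land it literally; (iv) `SystemZeroRepulsion_of : SystemZeroRepulsion` is now hypothesis-free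
(proof-of-item modulo the stub sorries), with `SystemZeroRepulsion_of_stubs` keeping the explicit-hypotheses form.
Registered stubs (5): `stub_longCyclesLattice` (lead), `stub_flowLinear`, `stub_fibreUniversality` (parity joint),
`stub_speciesCoupling`, `stub_farMomentWide` (S1′, shared).  Sorries: exactly these five.

Crux (route `route-Parity-AlmostPrimeZeros`, rank 2, FIXED): for every Bateman–Horn system `f = (f₁,…,f_k)` the zero
functional `T_f(x) = Σ_ρ ‖1-ρ‖⁻²` of the almost-prime polynomial `S_x(z) = Σ_{0≤n≤x} z^{s_f(n)}` (capped statistic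
`s_f(n) = Σ_i Σ_{p^v ∥ f_i(n)} min(v,2)`, roots over `ℂ` with multiplicity) is bounded in `x`.

Idea (card `Ideas/buchstab-flow-hyperbolicity.md`, triage r1-1/2/3: pass): factor the zero set into SPECIES.
`T` is controlled by (i) the Euler species `M_y = ∏_{p≤y} E_p` (exact local polynomials; `T(M_y) ≤ C_f` uniformly
in `y`, provable now), (ii) a species COUPLING matching the zeros of `S_x` with `‖z-1‖ ≤ K·log log x` to zeros of
`M_y · R_{x,y}` (`y = exp(log x/(log log x)^A)`, sieve-grade), (iii) a FAR ZONE bound (`‖1-ρ‖ > K log log x`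
contributes `O(1)`: Jensen at `1` + an exponential moment along `f`), and (iv) LATTICE DOMINATION of the rough
polynomial `R_{x,y}(z) = Σ_{n≤x} z^{s_{f,>y}(n)}`: no zero within `r₀` of `1` and at most `k·m + C₀` zeros with
`‖1-ρ‖ < m+1` — the finite-`x` shadow of "the zeros of `R` near `1` are REAL and sit to the LEFT of the lattice
`0,-1,-2,…` (multiplicity `k`)", which Abel summation turns into `T(R) ≤ C₀/r₀² + k·π²/6` (`LatticeSum`, PROVED in
this file: `latticeSum_holds`, annulus majorant + discrete Abel summation + `hasSum_zeta_two`).  The MECHANISM for (iv)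
is the Buchstab flow from its exactly solvable point: the long-cycle polynomials of the symmetric groups
`P_n^{(m₀)}(z) = Σ_{σ∈S_n} z^{#cycles of σ longer than m₀}` are real-rooted with their `j`-th largest zero `≤ -j`
(stub `LongCyclesLattice`; exact Sturm certificates: real-rootedness `n ≤ 200`, lattice count `n ≤ 56` — this
session), their `n/m₀ → u` limit is the common Poisson–Dirichlet/Buchstab profile `A_u` of `y`-rough prime
factors, and `R_{x,y}/x` tracks `∏_i A_{(deg f_i)·u}` (`u = (log log x)^A`).  The transfer is cut in two:
`FlowLinear` (f = X: anatomy of rough integers, Alladi–Buchstab laws; the calibration instance, cf. route item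
`LinearCappedRepulsion`) and `FibreUniversality` (linear ⇒ every system: the rough profile along `f` is the
integer one on every smooth fibre — the joint where `Literature.Barriers.Parity.SelbergParityBarrier` sits).

Shape (D-0027 §3.3; convention of Lines/inversion-defect-involution, Lines/pfaffian-square-address): each stub
statement is a `def <Name> : Prop`; the REGISTERED stub is `theorem stub_<name> : <Name> := by sorry`;
(the planner's `Registered.stub_<name>` aliases were dropped in reshape v1); the sorry-free composition
`SystemZeroRepulsion_of : (6 stubs) → AlmostPrimeZeros.SystemZeroRepulsion` concludes the crux BY NAME and is
the only theorem of the file doing so.  Sorries: exactly the six `stub_*` (`LongCyclesLattice`, `FlowLinear`,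
`FibreUniversality`, `EulerSpeciesBound`, `SpeciesCoupling`, `FarZone`).

Disproof.lean (cdisprove v1–v4, read through the item's evidence notes; the gate path is not mounted on this hub):
`not_uniformConstant` / `exists_system_T_two_gt` (no constant uniform in the system) — every constant below is
quantified AFTER `(k, f)`; `exists_system_root_near_one` (no zero-free disc at `1` uniform over systems, roots
within `ε` of `1` at `x = 2`) — `r₀` is per system and only for `x ≥ x₀`; `isBatemanHornSystem_empty`/`T_fin_zero`
(k = 0: `S_x = R = x+1`, `M_y = ∏ p²`, every statement below holds with all constants `0`); `withoutXGeTwo_iff`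
(`2 ≤ x` not load-bearing — the composition proves the bound for every `x`).  No `_false_without_` theorem and no
landed `Theorems/SystemZeroRepulsion/Negative/` lemma exist (2026-08-16).  Regime (iv) of its docblock ("far zone
free for general f") is DISPUTED by triage r1-2/r1-3 (for `deg ≥ 2` it is the open `FarMomentAlongSystem`);
this skeleton therefore files the far zone as its own stub (`FarZone`) instead of treating it as closed.
-/

open scoped BigOperators
open Polynomial

noncomputable section

namespace Summit.Parity.BatemanHorn.Cruxes.SystemZeroRepulsion.BuchstabFlowHyperbolicity

/-! ## §1 Objects (all over existing declarations; the crux's own expressions re-packaged as definitions) -/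

/-- The crux's zero functional `T(P) = Σ_ρ ‖1-ρ‖⁻²` (roots over `ℂ`, with multiplicity; `P = 0 ↦ 0`). -/
def zeroRepulsion (P : Polynomial ℂ) : ℝ :=
  (P.roots.map (fun ρ : ℂ => (‖(1 : ℂ) - ρ‖ ^ 2)⁻¹)).sum

/-- The capped statistic `s_f(n) = Σ_i Σ_{p^v ∥ f_i(n)} min(v,2)` — verbatim the crux's exponent
(`f_i(n) ≤ 0 ↦ 0` through `Int.toNat`). -/
def stat {k : ℕ} (f : Fin k → Polynomial ℤ) (n : ℕ) : ℕ :=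
  ∑ i, (((f i).eval (n : ℤ)).toNat.factorization.sum fun _ v => min v 2)

/-- The almost-prime polynomial `S_x(z) = Σ_{0 ≤ n ≤ x} z^{s_f(n)}` — verbatim the crux's polynomial. -/
def almostPrimePoly {k : ℕ} (f : Fin k → Polynomial ℤ) (x : ℕ) : Polynomial ℂ :=
  ∑ n ∈ Finset.range (x + 1), (Polynomial.X : Polynomial ℂ) ^ (stat f n)

/-- `L(x) = log log x`, the scale of the mean of `s_f` (route item `SystemMertens`: mean `= k·L(x) + O(1)`). -/
def LL (x : ℕ) : ℝ := Real.log (Real.log (x : ℝ))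

/-- NEAR part of `T(S_x)` at threshold `K`: roots with `‖1-ρ‖ ≤ K·log log x`. -/
def nearPart {k : ℕ} (f : Fin k → Polynomial ℤ) (K : ℝ) (x : ℕ) : ℝ :=
  (((almostPrimePoly f x).roots.filter fun ρ : ℂ => ‖(1 : ℂ) - ρ‖ ≤ K * LL x).map
    (fun ρ : ℂ => (‖(1 : ℂ) - ρ‖ ^ 2)⁻¹)).sum

/-- FAR part of `T(S_x)` at threshold `K`: roots with `‖1-ρ‖ > K·log log x`. -/
def farPart {k : ℕ} (f : Fin k → Polynomial ℤ) (K : ℝ) (x : ℕ) : ℝ :=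
  (((almostPrimePoly f x).roots.filter fun ρ : ℂ => ¬ (‖(1 : ℂ) - ρ‖ ≤ K * LL x)).map
    (fun ρ : ℂ => (‖(1 : ℂ) - ρ‖ ^ 2)⁻¹)).sum

/-- Capped LOCAL statistic at the prime `p`, a function of `n mod p²`:
`s_{f,p}(n) = Σ_i ([p ∣ f_i(n)] + [p² ∣ f_i(n)]) = Σ_i min(v_p(f_i(n)), 2)` (`f_i(n) = 0` counts `2`). -/
def localStat {k : ℕ} (f : Fin k → Polynomial ℤ) (p n : ℕ) : ℕ :=
  ∑ i, ((if ((p : ℤ) ∣ (f i).eval (n : ℤ)) then 1 else 0) +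
        (if ((p : ℤ) ^ 2 ∣ (f i).eval (n : ℤ)) then 1 else 0))

/-- Euler-species factor at `p`: the local generating polynomial `E_p(X) = Σ_{n < p²} X^{s_{f,p}(n)}`,
`E_p(1) = p²`, degree `≤ 2k` (the cap). For a generic prime (simple, pairwise distinct roots of the `f_i` mod `p`,
`ω = ω_f(p)`): `E_p/p² = (1 - ω/p) + ω(p-1)p⁻² X + ω p⁻² X²`, so `(1-z₁)(1-z₂) = p²/ω` (Vieta). -/
def eulerFactor {k : ℕ} (f : Fin k → Polynomial ℤ) (p : ℕ) : Polynomial ℂ :=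
  ∑ n ∈ Finset.range (p ^ 2), (Polynomial.X : Polynomial ℂ) ^ (localStat f p n)

/-- Euler species up to `y`: `M_y = ∏_{p ≤ y, p prime} E_p` (empty product `1` for `y < 2`). -/
def eulerSpecies {k : ℕ} (f : Fin k → Polynomial ℤ) (y : ℕ) : Polynomial ℂ :=
  ∏ p ∈ (Finset.range (y + 1)).filter Nat.Prime, eulerFactor f p

/-- Rough statistic: prime factors `> y` of the values, multiplicity capped at `2` (`f_i(n) ≤ 0 ↦ 0`, as in
the crux); `stat f n = (part at primes ≤ y) + roughStat f y n` termwise. -/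
def roughStat {k : ℕ} (f : Fin k → Polynomial ℤ) (y n : ℕ) : ℕ :=
  ∑ i, (((f i).eval (n : ℤ)).toNat.factorization.sum fun p v => if y < p then min v 2 else 0)

/-- Rough polynomial `R_{x,y}(X) = Σ_{0 ≤ n ≤ x} X^{roughStat f y n}` (the Γ-species of the zero set). -/
def roughPoly {k : ℕ} (f : Fin k → Polynomial ℤ) (x y : ℕ) : Polynomial ℂ :=
  ∑ n ∈ Finset.range (x + 1), (Polynomial.X : Polynomial ℂ) ^ (roughStat f y n)

/-- The small-prime cut `y_A(x) = ⌊exp(log x / (log log x)^A)⌋`, i.e. `u = log x/log y = (log log x)^A`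
(junk for `x ≤ 15`, where it is only ever used under `x₀ ≤ x`). -/
def cutoff (A : ℝ) (x : ℕ) : ℕ :=
  Nat.floor (Real.exp (Real.log (x : ℝ) / Real.log (Real.log (x : ℝ)) ^ A))

/-- LATTICE DOMINATION of a complex polynomial `P` with multiplicity budget `k`, excess `C₀`, inner radius `r₀`:
no root within `r₀` of `1`, and for every `m : ℕ` at most `k·m + C₀` roots with `‖1-ρ‖ < m+1` — the count profile
of `k` copies of the lattice `0,-1,-2,…` seen from `1`, up to `C₀` exceptions. -/
def LatticeDominated (k C₀ : ℕ) (r₀ : ℝ) (P : Polynomial ℂ) : Prop :=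
  (∀ ρ ∈ P.roots, r₀ ≤ ‖(1 : ℂ) - ρ‖) ∧
    ∀ m : ℕ, (P.roots.filter fun ρ : ℂ => ‖(1 : ℂ) - ρ‖ < (m : ℝ) + 1).card ≤ k * m + C₀

/-- The exactly solvable point of the Buchstab flow: the LONG-CYCLE polynomial of `S_n`,
`P_n^{(m₀)}(X) = Σ_{σ ∈ S_n} X^{#cycles of σ of length > m₀}` (`m₀ ≥ 1`; Mathlib's `cycleType` lists the
lengths `≥ 2` of the nontrivial cycles, so fixed points are never counted and `m₀ = 0` would coincide with
`m₀ = 1` — triage r1-1/r1-2 typing note, hence the hypothesis `1 ≤ m₀` below). Exponential formula: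
`P_n = Σ_{j=1}^{n} w_j · (n-1)!/(n-j)! · P_{n-j}`, `w_j = 1 (j ≤ m₀)`, `w_j = X (j > m₀)`, `P_0 = 1`. -/
def longCyclePoly (n m₀ : ℕ) : Polynomial ℝ :=
  ∑ σ : Equiv.Perm (Fin n),
    (Polynomial.X : Polynomial ℝ) ^ Multiset.card (σ.cycleType.filter fun l => m₀ < l)

/-! ## §2 The six stub statements (+ `LatticeSum`, proved in §4) -/

/-- **Stub 1 — `LongCyclesLattice` (the integrable point; combinatorics, size M–L).**
For all `n` and `m₀ ≥ 1`, `P_n^{(m₀)}` has only real zeros (`roots.card = natDegree` over `ℝ`), and they are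
dominated by the lattice FROM THE LEFT: for every `m : ℕ` at most `m` zeros satisfy `|1-ρ| < m+1`; since all
zeros are negative (positive coefficients) this says the `j`-th largest zero is `≤ -j` (`j = 0,1,2,…`).
Evidence: real-rootedness by exact Sturm sequences for `n ≤ 200`, `m₀ ≤ 10` (triage r1-1 kit j007468, r1-2
`sturm_longcycles.txt`, r1-3); the lattice count by exact Sturm counts at the integers `-m` for `n ≤ 56`,
`m₀ ∈ {1,…,6,8}` (this session, `compute/longcycles_lattice.py`, 0 exceptions; zeros e.g. `n = 24, m₀ = 2`:
`-0.000, -1.000, -2.013, -3.348, -6.320, -15.4, …`).  Why plausible: `m₀ = 1` satisfies the three-term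
recurrence `P_n = n·P_{n-1} - (n-1)(1-X)·P_{n-2}` (triage r1-1), an orthogonal-polynomial-type recursion on
`(-∞,1)` ⇒ interlacing; general `m₀`: compatibility / interlacing-preserver arguments along the exponential-formula
recurrence (ChudnovskySeymour2007, LiuWang2007 = arXiv:math/0509207, SavageVisontai2015 = arXiv:1208.3831,
BorceaBranden2009) and the `r`-associated Stirling numbers of the first kind (Ma 2010, zbl:1240.05002; Brenti) of
which `P_n^{(m₀)}` is a binomial convolution; large `n` at fixed `m₀`: `P_n(z)/n! ~ e^{(1-z)H_{m₀}} n^{z-1}/Γ(z)`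
(singularity analysis), zeros → the lattice.  Any fixed additive excess in the count would serve the line
equally (Hurwitz transfer in Stub 2); the sharp form is what the certificates show. -/
def LongCyclesLattice : Prop :=
  ∀ n m₀ : ℕ, 1 ≤ m₀ →
    (longCyclePoly n m₀).roots.card = (longCyclePoly n m₀).natDegree ∧
      ∀ m : ℕ, ((longCyclePoly n m₀).roots.filter fun ρ : ℝ => |1 - ρ| < (m : ℝ) + 1).card ≤ m

/-- Rough lattice count for ONE system `f` (multiplicity budget `k`): for every cut exponent `A ≥ 2` there are
`C₀`, `r₀ ∈ (0,1]` (an inner radius can always be shrunk), `x₀` with `R_{x, y_A(x)}` lattice-dominated for all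
`x ≥ x₀`. -/
def RoughLatticeCountFor {k : ℕ} (f : Fin k → Polynomial ℤ) : Prop :=
  ∀ A : ℝ, 2 ≤ A → ∃ C₀ : ℕ, ∃ r₀ : ℝ, 0 < r₀ ∧ r₀ ≤ 1 ∧ ∃ x₀ : ℕ, ∀ x : ℕ, x₀ ≤ x →
    LatticeDominated k C₀ r₀ (roughPoly f x (cutoff A x))

/-- **Stub 2 — `FlowLinear` (the Buchstab flow, linear case `k = 1, f = X`; anatomy, size L–XL; HARDEST-but-one).**
`LongCyclesLattice →` the rough polynomial `R_{x,y}(z) = Σ_{n ≤ x} z^{s_{>y}(n)}` of the INTEGERS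
(`y = y_A(x)`, `u = (log log x)^A`) is lattice-dominated with budget `1` for `x ≥ x₀(A)`.
Route inside the stub: (a) `P_n^{(⌊n/u⌋)}(z)/n! → A_u(z)` coefficientwise (cycles longer than `n/u` ↔
Poisson–Dirichlet atoms `> 1/u`; ArratiaBarbourTavare2003), so by Hurwitz `LongCyclesLattice` makes every
`A_u` real-rooted and lattice-dominated (`A_u(z) = ρ(u) + ∫₀^u ρ(s) B_{u-s}(z) ds`, `B_u = Σ_m g_m(u) z^m`,
Alladi1982's laws of `y`-rough integers with `m` prime factors; computed real-rooted for `u ∈ [1.5,12]` with zeros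
`0⁻, -1.000, -2.000, -3.04, -4.50, -7.45, …` marching onto the lattice from the left and `T(A_u) ↑ π²/6`, card §(2));
(b) finite-`x` tracking: `R_{x,y}(z)/x = A_{u}(z) + o_K(1)·(scale)` uniformly on `‖z-1‖ ≤ K'` with `u = u(x) → ∞`,
by the Buchstab identity `R_{x,y}(z) = Ψ(x,y) + z·Σ_{y<p≤x} R^{(p)}_{x/p,p}(z)` (classify `n` by its least prime
factor `> y`; the `p² ∣ n` terms, `O(x/y)` of them, carried as an error — triage r1-2 sharpening) and the
uniform Alladi/Hildebrand–Tenenbaum estimates for `Φ_m(x,y)`; (c) Rouché on the circles `‖z-1‖ = m + ½` and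
around the origin cluster transfers the COUNT (not literal real-rootedness: far tail pairs may be complex, cf.
the `𝔽_q[T]` thresholds of the card §(4) and `y ∈ {2,3}` at `x ≤ 10⁶`, triage r1-3) with `r₀, C₀` absorbing the
`k` origin-cluster zeros (triage r1-2 sharpen 2).  Numerics: `f = X`, `x = 10⁶`, `y ≥ 5`: all zeros of `R` real,
lattice excess `0` (`y = 7`: `-0.003, -1.316, -4.10, -11.95, -161.9`; card, triage r1-1/r1-3 `species_check.py`).
Why it might fail: the tracking (b) needs the rough local laws UNIFORMLY in `m ≤ K'` and `u = (log log x)^A → ∞`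
(Alladi's range is fixed `u`); a non-real pair of `A_u` for some large `u` would kill (a).  This stub + Stubs 4–6 (and `LatticeSum`) at
`k = 1` is the line's theorem-grade plan for the route's calibration item `LinearCappedRepulsion` (stmt-Parity-11327). -/
def FlowLinear : Prop :=
  LongCyclesLattice → RoughLatticeCountFor ![(Polynomial.X : Polynomial ℤ)]

/-- **Stub 3 — `FibreUniversality` (linear ⇒ every Bateman–Horn system; the PARITY joint, open-problem; HARDEST).**
The rough zero-count profile along any Bateman–Horn system is `k` copies of the integer one: from the lattice
domination of the integers' rough polynomial (Stub 2's conclusion, usable as the comparison object: the rough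
statistic of `f_i(n) ≍ x^{deg f_i}` is transferred from that of integers of the same size, fibre by fibre over
the smooth parts / root classes) conclude `LatticeDominated k C₀ r₀ (R^{(f)}_{x,y_A(x)})` for every system, every
`A ≥ 2`, `x ≥ x₀(f,A)`.  Conjectural limit: `R^{(f)}_{x,y}(z)/x → ∏_i A_{(deg f_i)·u}(z)` (independent rough parts;
a product of real-rooted lattice-dominated factors is lattice-dominated with budget `k`).  Numerics: `f = X²+1`,
`x = 10⁵`, `y ≥ 13`: zeros of `R` real; twins `(X,X+2)`: real apart from the origin double zero splitting to
`±0.03i` (`‖1-ρ‖ > 1`, inside the `C₀` budget) (card §(1)).  Why it might fail / barrier: at `z = -1` this contains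
the rough Liouville function along `f` (`R(-1)`), i.e. the crux's parity content relocated to the roughest
species — `Literature.Barriers.Parity.SelbergParityBarrier` bites HERE and only here (the twin `1 + λ_{>y}(∏f_i(n))`
has `R^{tw} = 2·Even(R)` with zeros ON `iℝ`; the Buchstab recursion maps the even twin at scale `x` to `z ×` ODD
twins at scales `x/p`, so the true family is closed under the flow and the twin family is not — the structural
asymmetry an interlacing induction would have to exploit, card "Disproof used"); for `deg f_i ≥ 2` even the
parity-blind coefficients `r_m(x)/x` (smooth/rough values of polynomials at `u = (log log x)^A`) are not in print
(DMT2001/Martin2002 ranges are `u = O(1)`), and `FunctionFieldMobiusBias` shows the statement FAILS for inseparable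
CCG-type `f` over `𝔽_q[T]` (zeros on `iℝ`) — the integer analogue must use irreducibility + non-association
(the refuters' load-bearing hypotheses: `(X,X)`, `X²` give `R(z) = P(z²)`). -/
def FibreUniversality : Prop :=
  RoughLatticeCountFor ![(Polynomial.X : Polynomial ℤ)] →
    ∀ (k : ℕ) (f : Fin k → Polynomial ℤ), Literature.NumberTheory.Sieve.IsBatemanHornSystem f →
      RoughLatticeCountFor f

/-- **`LatticeSum` (Abel summation; NOT a stub — proved in §4 as `latticeSum_holds`; card `LatticeCountBound`).**
Lattice domination bounds the zero functional: sort the roots by `d = ‖1-ρ‖`; the first `C₀` have `d ≥ r₀`, and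
the `(C₀+1+i)`-th has `d ≥ ⌊i/k⌋ + 1` (else `N(⌊i/k⌋+1) > k⌊i/k⌋ + C₀`), so
`T(P) ≤ C₀/r₀² + Σ_{i≥0} (⌊i/k⌋+1)⁻² = C₀/r₀² + k·π²/6` (`hasSum_zeta_two`); `k = 0`: at most `C₀` roots, all at
distance `≥ r₀`.  Equivalently, by annuli: `T ≤ |A₀| r₀⁻² + Σ_{m≥1} |A_m| m⁻²` and discrete Abel summation against the
partial sums `Σ_{j≤m} |A_j| ≤ km + C₀` with the DECREASING weights `r₀⁻² ≥ 1 ≥ 1/4 ≥ …` (this is where `r₀ ≤ 1` is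
used; the statement stays true without it, by the sorting argument).  (Card `LatticeCountBound`, generalised by
`C₀, r₀` as triage r1-2 sharpen 2 requires.) -/
def LatticeSum : Prop :=
  ∀ (k C₀ : ℕ) (r₀ : ℝ) (P : Polynomial ℂ), 0 < r₀ → r₀ ≤ 1 → LatticeDominated k C₀ r₀ P →
    zeroRepulsion P ≤ (C₀ : ℝ) / r₀ ^ 2 + (k : ℝ) * (Real.pi ^ 2 / 6)

/-- **Stub 4 — `EulerSpeciesBound` (local algebra + a convergent prime sum; size M, provable now — triage r1-1/2/3
verified the algebra).**  `T(M_y) = Σ_{p ≤ y} T(E_p) ≤ C_f` uniformly in `y` (`T` is additive over products,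
`Polynomial.roots_mul`): generic `p` gives `(1-z₁)(1-z₂) = p²/ω_f(p)`, a complex pair with `T(E_p) = 2ω/p²` or a real
pair with `1 - z₊ ≥ p²/(ω(p+1)) > 1` (uses `ω_f(p) < p`: `hasNoFixedPrimeDivisor`) and `T(E_p) ≤ 2ω²(p+1)²/p⁴`; the
finitely many `p ∣ ∏ disc f_i · ∏ Res(f_i,f_j)` have `E_p(1) = p² ≠ 0`, finite `T`; `k = 0`: `E_p = p²`, `T = 0`.
Predicted `lim_y T(M_y)`: `2Σ_p p⁻² = 0.904 (X)`, `0.46 (X²+1)`, `3.06 ((X,X+2))` (card, Transfer). -/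
def EulerSpeciesBound : Prop :=
  ∀ (k : ℕ) (f : Fin k → Polynomial ℤ), Literature.NumberTheory.Sieve.IsBatemanHornSystem f →
    ∃ C : ℝ, ∀ y : ℕ, zeroRepulsion (eulerSpecies f y) ≤ C

/-- **Stub 5 — `SpeciesCoupling` (near zone, Rouché-grade; sieve-grade for `f = X`, size L; for `deg ≥ 2`/`k ≥ 2`
it needs the rough profile equidistributed over smooth fibres — level-of-distribution content, open).**
For every system, every `K > 0`, some cut exponent `A ≥ 2` (chosen here, AFTER `K`: `A > 2` makes the sieve level
`y^{O(Kℓ²)} = x^{o(1)}` and the fundamental-lemma saving `e^{-u log u}`, `u = ℓ^A`, beat the cancellation factor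
`e^{-2kKℓ²}` of the main term on `‖z-1‖ ≤ Kℓ`, `ℓ = log log x`; triage r1-2: `A_f ≥ 4D₀+2` for the crude tails) and
`x ≥ x₀`: the near part of `T(S_x)` is at most `T(M_y) + T(R_{x,y}) + C`.  Route inside: `S_x(z) ≈ x⁻¹·M_y(z)/M_y(1)
· R_{x,y}(z)` with error `x·e^{-c ℓ^A log ℓ}` uniformly on `‖z-1‖ ≤ Kℓ` (regroup `n` by its smooth fibre; for `f = X`
the exact factorisation `S_x = Σ_{a smooth} z^{s(a)} R_{x/a,y}` + scale regularity of `R` in `x`; in general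
rough-profile-descent's `TruncatedEulerProduct`, divisor expansion over cube-free smooth `e ≤ x^{1-ε}` + CRT +
Rankin), then Rouché on the circles `‖z-1‖ = m+½ (m ≤ Kℓ)` and on small circles about the `E_p`-zero clusters
(`‖1-z_p‖² = p²/ω_f(p)`), where `|main| ≥ x·u^{-K ℓ-1}·e^{-O(Kℓ log(Kℓ))} ≫ error`; matched zeros are `o(1)`-close
with `‖1-ρ‖ ≥ r₀`, so their `‖1-ρ‖⁻²` sums differ by `o(1)`.  Why it might fail: for `deg f_i ≥ 2` the fibre
equidistribution of `z^{s_{>y}(f_i(n))}` in classes to smooth moduli expands into rough divisors of `f_i(n)` beyond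
level `x` (Disproof v3/v4 docblock: "core disc = level-of-distribution-complete beyond x, parity-free"). -/
def SpeciesCoupling : Prop :=
  ∀ (k : ℕ) (f : Fin k → Polynomial ℤ), Literature.NumberTheory.Sieve.IsBatemanHornSystem f →
    ∀ K : ℝ, 0 < K → ∃ A : ℝ, 2 ≤ A ∧ ∃ C : ℝ, ∃ x₀ : ℕ, ∀ x : ℕ, x₀ ≤ x →
      nearPart f K x ≤ zeroRepulsion (eulerSpecies f (cutoff A x)) + zeroRepulsion (roughPoly f x (cutoff A x)) + C

/-- **Stub 6 — `FarZone` (Jensen at `1` + exponential moment along `f`; a theorem for `k = 1`, `f` linear, size M;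
for `deg ≥ 2`/`k ≥ 2` the open, parity-FREE anatomy statement `FarMomentAlongSystem` of card
far-zone-hardy-ramanujan-along-f — the stub every line of this crux needs, filed once here as triage r1-2 asks).**
For every system there are `K, C, x₀` with `Σ_{‖1-ρ‖ > K log log x} ‖1-ρ‖⁻² ≤ C` for `x ≥ x₀`: nonnegative
coefficients give `max_{‖z-1‖=r} |S_x| ≤ S_x(1+r)`, Jensen `N₁(r) ≤ log(S_x(1+er)/(x+1))`, the far sum is
`≤ 2∫_{Kℓ}^∞ N₁(r) r⁻³ dr`, and `log(S_x(t)/x) ≤ C·t·ℓ` for `t ≤ e·√(deg S_x)` closes it with `O(1/K)`; for `f = X`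
the moment bound is Rankin–Mertens (`Σ_d g_t(d)⌊x/d⌋ ≤ x∏_p(1+(t-1)/p+(t²-t)/p²)`, refuter EVIDENCE.md §5), for
`deg ≥ 2` it is a Hardy–Ramanujan inequality along `f` uniform in the number of prime factors (Tenenbaum 1990-type;
exponent `a < 2` needed, level-`x` methods give `a = D₀` — triage r1-2/r1-3, DISPUTING Disproof v4 regime (iv)). -/
def FarZone : Prop :=
  ∀ (k : ℕ) (f : Fin k → Polynomial ℤ), Literature.NumberTheory.Sieve.IsBatemanHornSystem f →
    ∃ K : ℝ, 0 < K ∧ ∃ C : ℝ, ∃ x₀ : ℕ, ∀ x : ℕ, x₀ ≤ x → farPart f K x ≤ C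

/-- **Stub 6′ — `FarMomentWide` (S1′ of line smooth-rough-lattice-acquisition, VERBATIM; the shared parity-free anatomy
input of every line of this crux).**  For every Bateman–Horn system, `Σ_{n ≤ x} t^{s_f(n)} ≤ (x+1)·exp(C·(t·log log x +
t²/log log x))` for `x ≥ 3`, `1 ≤ t ≤ √(log x)`.  THEOREM for `k ≤ 1`, `deg ≤ 1` (seat a,
`…SmoothRoughLatticeAcquisition.stub_farMomentWide_linear`); open (Nair–Tenenbaum-grade anatomy with the tilt `t` growing)
for `Σ deg ≥ 2`; for `Σ deg ≥ 3` hostage to ultra-champions exactly as the crux is (seat a's degree bound p83405).  It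
implies this line's `FarZone` (with `K = 1`) through seat a's landed `stub_farZone_of_farMomentWide` — see
`farZone_of_farMomentWide` in §4. -/
def FarMomentWide : Prop :=
  ∀ (k : ℕ) (f : Fin k → Polynomial ℤ), Literature.NumberTheory.Sieve.IsBatemanHornSystem f →
    ∃ C : ℝ, ∀ x : ℕ, 3 ≤ x → ∀ t : ℝ, 1 ≤ t → t ≤ Real.sqrt (Real.log (x : ℝ)) →
      (∑ n ∈ Finset.range (x + 1), (t : ℝ) ^ (∑ i, (((f i).eval (n : ℤ)).toNat.factorization.sum fun _ v => min v 2))) ≤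
        ((x : ℝ) + 1) * Real.exp (C * (t * Real.log (Real.log (x : ℝ)) + t ^ 2 / Real.log (Real.log (x : ℝ))))

/-! ## §3 The registered stubs (the ONLY sorries of the file) -/

/-- Registered stub 1: the `sorry` of `LongCyclesLattice`, signature INLINE (the long-cycle polynomial
`P_n^{(m₀)} = Σ_{σ ∈ S_n} X^{#cycles of σ longer than m₀}` written out over `Equiv.Perm.cycleType`). -/
theorem stub_longCyclesLattice :
    ∀ n m₀ : ℕ, 1 ≤ m₀ →
      (∑ σ : Equiv.Perm (Fin n), (Polynomial.X : Polynomial ℝ) ^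
          Multiset.card (σ.cycleType.filter fun l => m₀ < l)).roots.card =
        (∑ σ : Equiv.Perm (Fin n), (Polynomial.X : Polynomial ℝ) ^
          Multiset.card (σ.cycleType.filter fun l => m₀ < l)).natDegree ∧
      ∀ m : ℕ, ((∑ σ : Equiv.Perm (Fin n), (Polynomial.X : Polynomial ℝ) ^
          Multiset.card (σ.cycleType.filter fun l => m₀ < l)).roots.filter
            fun ρ : ℝ => |1 - ρ| < (m : ℝ) + 1).card ≤ m := by
  sorry

/-- Registered stub 2: the `sorry` of `FlowLinear`. -/
theorem stub_flowLinear : FlowLinear := by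
  sorry

/-- Registered stub 3: the `sorry` of `FibreUniversality` (hardest: the parity joint). -/
theorem stub_fibreUniversality : FibreUniversality := by
  sorry

/-- Registered stub 5: the `sorry` of `SpeciesCoupling`. -/
theorem stub_speciesCoupling : SpeciesCoupling := by
  sorry

/-- Registered stub 6′: the `sorry` of `FarMomentWide` (S1′, shared with the other two lines; statement inline). -/
theorem stub_farMomentWide :
    ∀ (k : ℕ) (f : Fin k → Polynomial ℤ), Literature.NumberTheory.Sieve.IsBatemanHornSystem f →
      ∃ C : ℝ, ∀ x : ℕ, 3 ≤ x → ∀ t : ℝ, 1 ≤ t → t ≤ Real.sqrt (Real.log (x : ℝ)) →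
        (∑ n ∈ Finset.range (x + 1), (t : ℝ) ^ (∑ i, (((f i).eval (n : ℤ)).toNat.factorization.sum fun _ v => min v 2))) ≤
          ((x : ℝ) + 1) * Real.exp (C * (t * Real.log (Real.log (x : ℝ)) + t ^ 2 / Real.log (Real.log (x : ℝ)))) := by
  sorry


/-! ## §4 Sorry-free glue -/

/-! ### Abel summation for `LatticeSum` (PROVED here; it was the card's `LatticeCountBound`) -/

/-- Annulus weights `w := latticeWeight r₀`: `w 0 = r₀⁻²`, `w m = m⁻²` for `m ≥ 1`. -/
def latticeWeight (r₀ : ℝ) (m : ℕ) : ℝ := if m = 0 then (r₀ ^ 2)⁻¹ else ((m : ℝ) ^ 2)⁻¹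

lemma latticeWeight_zero (r₀ : ℝ) : latticeWeight r₀ 0 = (r₀ ^ 2)⁻¹ := by simp [latticeWeight]

lemma latticeWeight_succ (r₀ : ℝ) (m : ℕ) : latticeWeight r₀ (m + 1) = (((m : ℝ) + 1) ^ 2)⁻¹ := by
  simp [latticeWeight]

lemma latticeWeight_nonneg (r₀ : ℝ) (m : ℕ) : 0 ≤ latticeWeight r₀ m := by
  unfold latticeWeight; split_ifs <;> positivity

lemma latticeWeight_succ_le {r₀ : ℝ} (hr₀ : 0 < r₀) (hr₁ : r₀ ≤ 1) (m : ℕ) : latticeWeight r₀ (m + 1) ≤ latticeWeight r₀ m := by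
  rcases m with _ | m
  · rw [latticeWeight_succ, latticeWeight_zero]
    have h1 : r₀ ^ 2 ≤ 1 := pow_le_one₀ hr₀.le hr₁
    have h2 : 0 < r₀ ^ 2 := by positivity
    calc ((((0 : ℕ) : ℝ) + 1) ^ 2)⁻¹ = 1 := by norm_num
      _ ≤ (r₀ ^ 2)⁻¹ := (one_le_inv₀ h2).mpr h1
  · rw [latticeWeight_succ, latticeWeight_succ]
    apply inv_anti₀ (by positivity)
    push_cast
    have hm : (0 : ℝ) ≤ (m : ℝ) := Nat.cast_nonneg m
    nlinarith

/-- Annulus majorant: `d⁻² ≤ w ⌊d⌋₊` for `d ≥ r₀ > 0`. -/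
lemma inv_sq_le_latticeWeight {r₀ d : ℝ} (hr₀ : 0 < r₀) (hd : r₀ ≤ d) : (d ^ 2)⁻¹ ≤ latticeWeight r₀ ⌊d⌋₊ := by
  have hd0 : 0 < d := lt_of_lt_of_le hr₀ hd
  rcases Nat.eq_zero_or_pos ⌊d⌋₊ with h0 | hpos
  · rw [h0, latticeWeight_zero]
    exact inv_anti₀ (by positivity) (by gcongr)
  · obtain ⟨m, hm⟩ : ∃ m, ⌊d⌋₊ = m + 1 := Nat.exists_eq_succ_of_ne_zero (by omega)
    rw [hm, latticeWeight_succ]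
    apply inv_anti₀ (by positivity)
    have hle : ((m : ℝ) + 1) ≤ d := by
      have h := Nat.floor_le hd0.le
      rw [hm] at h
      push_cast at h
      exact h
    have hm0 : (0 : ℝ) ≤ (m : ℝ) + 1 := by positivity
    gcongr

/-- Telescoping: `Σ_{j < M} [a ≤ j] (w j - w (j+1)) = w a - w M` for `a ≤ M`. -/
lemma sum_indicator_telescope (r₀ : ℝ) {a M : ℕ} (haM : a ≤ M) :
    ∑ j ∈ Finset.range M, (if a ≤ j then latticeWeight r₀ j - latticeWeight r₀ (j + 1) else 0) = latticeWeight r₀ a - latticeWeight r₀ M := by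
  induction M with
  | zero =>
    have : a = 0 := Nat.le_zero.mp haM
    subst this; simp
  | succ M ih =>
    rcases Nat.eq_or_lt_of_le haM with h | h
    · -- a = M + 1: every indicator vanishes
      subst h
      rw [Finset.sum_eq_zero]
      · ring
      intro j hj
      have : j < M + 1 := Finset.mem_range.mp hj
      rw [if_neg (by omega)]
    · rw [Finset.sum_range_succ, ih (by omega), if_pos (by omega)]
      ring

/-- Abel identity behind the bound:
`Σ_{j<M} (w j - w (j+1)) (k j + C₀) + w M (k (M-1) + C₀) = C₀ w 0 + k Σ_{j ∈ [1,M)} w j` for `M ≥ 1`. -/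
lemma abel_identity (r₀ : ℝ) (k C₀ : ℝ) (M : ℕ) (hM : 1 ≤ M) :
    ∑ j ∈ Finset.range M, (latticeWeight r₀ j - latticeWeight r₀ (j + 1)) * (k * j + C₀) + latticeWeight r₀ M * (k * ((M : ℝ) - 1) + C₀)
      = C₀ * latticeWeight r₀ 0 + k * ∑ j ∈ Finset.Ico 1 M, latticeWeight r₀ j := by
  induction M, hM using Nat.le_induction with
  | base =>
    simp only [Finset.sum_range_one, Finset.Ico_self, Finset.sum_empty, Nat.cast_zero, Nat.cast_one,
      mul_zero, zero_add, sub_self, add_zero]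
    ring
  | succ M hM ih =>
    rw [Finset.sum_range_succ, Finset.sum_Ico_succ_top hM]
    push_cast
    linear_combination ih

/-- The weighted-count identity (induction on the multiset): for `D` with all `0 ≤ d` and `⌊d⌋₊ < M`,
`Σ_{d∈D} w ⌊d⌋₊ = Σ_{j<M} (w j - w (j+1)) · #{d ∈ D : d < j+1} + w M · |D|`. -/
lemma sum_latticeWeight_floor_eq (r₀ : ℝ) (M : ℕ) (D : Multiset ℝ) (hD : ∀ d ∈ D, 0 ≤ d ∧ ⌊d⌋₊ < M) :
    (D.map fun d => latticeWeight r₀ ⌊d⌋₊).sum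
      = ∑ j ∈ Finset.range M, (latticeWeight r₀ j - latticeWeight r₀ (j + 1)) * ((D.filter fun d => d < (j : ℝ) + 1).card : ℝ)
        + latticeWeight r₀ M * (D.card : ℝ) := by
  induction D using Multiset.induction_on with
  | empty => simp
  | cons a D ih =>
    have ha := hD a (Multiset.mem_cons_self a D)
    have hD' : ∀ d ∈ D, 0 ≤ d ∧ ⌊d⌋₊ < M := fun d hd => hD d (Multiset.mem_cons_of_mem hd)
    have hfilt : ∀ j : ℕ, ((Multiset.filter (fun d => d < (j : ℝ) + 1) (a ::ₘ D)).card : ℝ)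
        = ((Multiset.filter (fun d => d < (j : ℝ) + 1) D).card : ℝ) + (if ⌊a⌋₊ ≤ j then 1 else 0) := by
      intro j
      by_cases h : a < (j : ℝ) + 1
      · rw [Multiset.filter_cons_of_pos (p := fun d => d < (j : ℝ) + 1) D h, Multiset.card_cons]
        have hle : ⌊a⌋₊ ≤ j := by
          have h2 : a < ((j + 1 : ℕ) : ℝ) := by exact_mod_cast h
          have h3 : ⌊a⌋₊ < j + 1 := (Nat.floor_lt ha.1).mpr h2
          omega
        rw [if_pos hle]
        push_cast
        ring
      · rw [Multiset.filter_cons_of_neg (p := fun d => d < (j : ℝ) + 1) D h]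
        have hnot : ¬ ⌊a⌋₊ ≤ j := by
          intro hle
          apply h
          have h3 : a < ((j + 1 : ℕ) : ℝ) := (Nat.floor_lt ha.1).mp (by omega)
          exact_mod_cast h3
        rw [if_neg hnot]
        ring
    have htel : ∑ j ∈ Finset.range M, (latticeWeight r₀ j - latticeWeight r₀ (j + 1)) * (if ⌊a⌋₊ ≤ j then (1 : ℝ) else 0)
        = latticeWeight r₀ ⌊a⌋₊ - latticeWeight r₀ M := by
      rw [← sum_indicator_telescope r₀ ha.2.le]
      refine Finset.sum_congr rfl fun j _ => ?_
      split_ifs <;> simp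
    rw [Multiset.map_cons, Multiset.sum_cons, ih hD', Multiset.card_cons]
    simp_rw [hfilt, mul_add]
    rw [Finset.sum_add_distrib, htel]
    push_cast
    ring

/-- **`LatticeSum` holds** (annulus majorant + discrete Abel summation + `hasSum_zeta_two`). -/
theorem latticeSum_holds : LatticeSum := by
  intro k C₀ r₀ P hr₀ hr₁ hLD
  obtain ⟨hfar, hcount⟩ := hLD
  set D : Multiset ℝ := P.roots.map (fun ρ : ℂ => ‖(1 : ℂ) - ρ‖) with hDdef
  have hDmem : ∀ d ∈ D, r₀ ≤ d := by
    intro d hd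
    obtain ⟨ρ, hρ, rfl⟩ := Multiset.mem_map.mp hd
    exact hfar ρ hρ
  have hDcount : ∀ m : ℕ, ((D.filter fun d => d < (m : ℝ) + 1).card : ℝ) ≤ k * m + C₀ := by
    intro m
    have h := hcount m
    have e : (D.filter fun d => d < (m : ℝ) + 1).card
        = (P.roots.filter fun ρ : ℂ => ‖(1 : ℂ) - ρ‖ < (m : ℝ) + 1).card := by
      rw [hDdef, ← Multiset.countP_eq_card_filter, Multiset.countP_map]
    rw [e]
    exact_mod_cast h
  have hT : zeroRepulsion P = (D.map fun d => (d ^ 2)⁻¹).sum := by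
    rw [zeroRepulsion, hDdef, Multiset.map_map]
    rfl
  -- Step A: annulus majorant
  have hA : (D.map fun d => (d ^ 2)⁻¹).sum ≤ (D.map fun d => latticeWeight r₀ ⌊d⌋₊).sum :=
    Multiset.sum_map_le_sum_map _ _ fun d hd => inv_sq_le_latticeWeight hr₀ (hDmem d hd)
  -- Step B: the identity at a level M above every annulus index
  set M : ℕ := (D.map fun d => ⌊d⌋₊).sup + 1 with hMdef
  have hDM : ∀ d ∈ D, 0 ≤ d ∧ ⌊d⌋₊ < M := by
    intro d hd
    refine ⟨hr₀.le.trans (hDmem d hd), ?_⟩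
    have : ⌊d⌋₊ ≤ (D.map fun d => ⌊d⌋₊).sup := Multiset.le_sup (Multiset.mem_map_of_mem _ hd)
    omega
  have hB := sum_latticeWeight_floor_eq r₀ M D hDM
  have hM1 : 1 ≤ M := by omega
  have hcardD : (D.card : ℝ) ≤ k * ((M : ℝ) - 1) + C₀ := by
    have hfilt : (D.filter fun d => d < ((M - 1 : ℕ) : ℝ) + 1) = D := by
      apply Multiset.filter_eq_self.mpr
      intro d hd
      have h1 := (hDM d hd).2
      have h2 : d < (⌊d⌋₊ : ℝ) + 1 := Nat.lt_floor_add_one d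
      have h3 : (⌊d⌋₊ : ℝ) ≤ ((M - 1 : ℕ) : ℝ) := by
        have : ⌊d⌋₊ ≤ M - 1 := by omega
        exact_mod_cast this
      linarith
    have h := hDcount (M - 1)
    rw [hfilt] at h
    have e : ((M - 1 : ℕ) : ℝ) = (M : ℝ) - 1 := by
      rw [Nat.cast_sub hM1]
      simp
    rw [e] at h
    exact h
  -- Step C: Abel summation against the cumulative counts
  have hΔ : ∀ j, 0 ≤ latticeWeight r₀ j - latticeWeight r₀ (j + 1) := fun j => sub_nonneg.mpr (latticeWeight_succ_le hr₀ hr₁ j)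
  have hC : ∑ j ∈ Finset.range M, (latticeWeight r₀ j - latticeWeight r₀ (j + 1)) * ((D.filter fun d => d < (j : ℝ) + 1).card : ℝ)
        + latticeWeight r₀ M * (D.card : ℝ)
      ≤ ∑ j ∈ Finset.range M, (latticeWeight r₀ j - latticeWeight r₀ (j + 1)) * (k * j + C₀)
        + latticeWeight r₀ M * (k * ((M : ℝ) - 1) + C₀) :=
    add_le_add (Finset.sum_le_sum fun j _ => mul_le_mul_of_nonneg_left (hDcount j) (hΔ j))
      (mul_le_mul_of_nonneg_left hcardD (latticeWeight_nonneg r₀ M))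
  rw [abel_identity r₀ k C₀ M hM1] at hC
  -- Step D: ζ(2)
  have hZ : ∑ j ∈ Finset.Ico 1 M, latticeWeight r₀ j ≤ Real.pi ^ 2 / 6 := by
    have hs : ∑ j ∈ Finset.Ico 1 M, latticeWeight r₀ j = ∑ j ∈ Finset.Ico 1 M, 1 / (j : ℝ) ^ 2 := by
      refine Finset.sum_congr rfl fun j hj => ?_
      have hj1 : 1 ≤ j := (Finset.mem_Ico.mp hj).1
      rw [latticeWeight, if_neg (by omega), one_div]
    rw [hs]
    exact sum_le_hasSum _ (fun j _ => by positivity) hasSum_zeta_two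
  have hk : (0 : ℝ) ≤ (k : ℝ) := by positivity
  calc zeroRepulsion P = (D.map fun d => (d ^ 2)⁻¹).sum := hT
    _ ≤ (D.map fun d => latticeWeight r₀ ⌊d⌋₊).sum := hA
    _ = _ := hB
    _ ≤ C₀ * latticeWeight r₀ 0 + k * ∑ j ∈ Finset.Ico 1 M, latticeWeight r₀ j := hC
    _ ≤ C₀ * (r₀ ^ 2)⁻¹ + k * (Real.pi ^ 2 / 6) := by
        rw [latticeWeight_zero]
        linarith [mul_le_mul_of_nonneg_left hZ hk]
    _ = (C₀ : ℝ) / r₀ ^ 2 + (k : ℝ) * (Real.pi ^ 2 / 6) := by ring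


/-- Species bookkeeping for the crux functional: `T(S_x) = near part + far part` at any threshold `K`
(`Multiset.filter_add_not`). -/
theorem zeroRepulsion_eq_nearPart_add_farPart {k : ℕ} (f : Fin k → Polynomial ℤ) (K : ℝ) (x : ℕ) :
    zeroRepulsion (almostPrimePoly f x) = nearPart f K x + farPart f K x := by
  unfold zeroRepulsion nearPart farPart
  rw [← Multiset.sum_add, ← Multiset.map_add, Multiset.filter_add_not]

/-- An eventual bound on a real sequence is a bound everywhere (finitely many earlier values): this is why
`2 ≤ x` in the crux is not load-bearing (Disproof `withoutXGeTwo_iff`) and why every stub may carry its own `x₀`. -/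
theorem forall_le_of_eventually_le {T : ℕ → ℝ} {C : ℝ} {x₀ : ℕ} (h : ∀ x, x₀ ≤ x → T x ≤ C) :
    ∃ C' : ℝ, ∀ x, T x ≤ C' := by
  refine ⟨|C| + ∑ i ∈ Finset.range x₀, |T i|, fun x => ?_⟩
  have hsum : 0 ≤ ∑ i ∈ Finset.range x₀, |T i| := Finset.sum_nonneg fun i _ => abs_nonneg _
  rcases Nat.lt_or_ge x x₀ with hx | hx
  · have hmem : x ∈ Finset.range x₀ := Finset.mem_range.mpr hx
    calc T x ≤ |T x| := le_abs_self _
      _ ≤ ∑ i ∈ Finset.range x₀, |T i| := Finset.single_le_sum (fun i _ => abs_nonneg (T i)) hmem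
      _ ≤ |C| + ∑ i ∈ Finset.range x₀, |T i| := le_add_of_nonneg_left (abs_nonneg C)
  · calc T x ≤ C := h x hx
      _ ≤ |C| := le_abs_self C
      _ ≤ |C| + ∑ i ∈ Finset.range x₀, |T i| := le_add_of_nonneg_right hsum

/-! ### Joints closed from the tree -/

/-- `LongCyclesLattice` is the registered stub 1 (definitional unfolding of `longCyclePoly`). -/
theorem longCyclesLattice_of_stub : LongCyclesLattice := stub_longCyclesLattice

/-- `FarMomentWide` is the registered stub 6′. -/
theorem farMomentWide_of_stub : FarMomentWide := stub_farMomentWide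

/-- **`EulerSpeciesBound` holds** — it is seat b's landed theorem
`…EulerSpeciesFactorisation.stub_eulerSpeciesBound` (Theorems/AlmostPrimeZerosSystemZeroRepulsionEulerSpeciesBound.lean,
p91899) after unfolding `zeroRepulsion`, `eulerSpecies`, `eulerFactor`, `localStat`. -/
theorem eulerSpeciesBound_holds : EulerSpeciesBound := by
  intro k f hf
  exact Summit.Parity.BatemanHorn.Cruxes.SystemZeroRepulsion.EulerSpeciesFactorisation.stub_eulerSpeciesBound k f hf

/-- **`FarMomentWide → FarZone`** (with `K = 1`): seat a's landed `stub_farZone_of_farMomentWide` bounds the sum over the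
roots with `log log x ≤ ‖1-ρ‖`; `farPart f 1 x` sums the same non-negative terms over the sub-multiset `¬(‖1-ρ‖ ≤ 1·log log x)`. -/
theorem farZone_of_farMomentWide (h : FarMomentWide) : FarZone := by
  intro k f hf
  obtain ⟨C, x₀, hC⟩ :=
    Summit.Parity.BatemanHorn.Cruxes.SystemZeroRepulsion.SmoothRoughLatticeAcquisition.stub_farZone_of_farMomentWide
      h k f hf
  refine ⟨1, one_pos, C, x₀, fun x hx => le_trans ?_ (hC x hx)⟩
  unfold farPart almostPrimePoly stat LL
  set R := (∑ n ∈ Finset.range (x + 1), (Polynomial.X : Polynomial ℂ) ^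
      (∑ i, (((f i).eval (n : ℤ)).toNat.factorization.sum fun _ v => min v 2))).roots with hR
  have hsub : (R.filter fun ρ : ℂ => ¬ (‖(1 : ℂ) - ρ‖ ≤ 1 * Real.log (Real.log (x : ℝ)))) ≤
      (R.filter fun ρ : ℂ => Real.log (Real.log (x : ℝ)) ≤ ‖(1 : ℂ) - ρ‖) :=
    Multiset.monotone_filter_right R (fun ρ hρ => by rw [one_mul] at hρ; exact (not_le.mp hρ).le)
  obtain ⟨u, hu⟩ := Multiset.le_iff_exists_add.mp hsub
  rw [hu, Multiset.map_add, Multiset.sum_add]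
  have hnn : 0 ≤ (u.map fun ρ : ℂ => (‖(1 : ℂ) - ρ‖ ^ 2)⁻¹).sum :=
    Multiset.sum_nonneg fun t ht => by
      obtain ⟨ρ, -, rfl⟩ := Multiset.mem_map.mp ht
      positivity
  linarith

/-! ### The composition -/

/-- The line's bound for ONE system past all thresholds, from the five stub STATEMENTS: far zone (⇐ S1′) + coupling + Euler
species (tree) + (flow ⇒ lattice count ⇒ Abel summation, `latticeSum_holds`) give
`T(S_x) ≤ C_M + (C₀/r₀² + kπ²/6) + C_cpl + C_far` for `x ≥ x₀`. -/
theorem eventually_bounded (h₁ : LongCyclesLattice) (h₂ : FlowLinear) (h₃ : FibreUniversality)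
    (h₆ : SpeciesCoupling) (h₇ : FarMomentWide)
    {k : ℕ} (f : Fin k → Polynomial ℤ) (hf : Literature.NumberTheory.Sieve.IsBatemanHornSystem f) :
    ∃ C : ℝ, ∃ x₀ : ℕ, ∀ x : ℕ, x₀ ≤ x → zeroRepulsion (almostPrimePoly f x) ≤ C := by
  obtain ⟨K, hK, C₁, x₁, hfar⟩ := farZone_of_farMomentWide h₇ k f hf
  obtain ⟨A, hA, C₂, x₂, hcpl⟩ := h₆ k f hf K hK
  obtain ⟨C₃, hsp⟩ := eulerSpeciesBound_holds k f hf
  obtain ⟨C₀, r₀, hr₀, hr₁, x₃, hlat⟩ := h₃ (h₂ h₁) k f hf A hA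
  refine ⟨C₃ + ((C₀ : ℝ) / r₀ ^ 2 + (k : ℝ) * (Real.pi ^ 2 / 6)) + C₂ + C₁, max x₁ (max x₂ x₃), fun x hx => ?_⟩
  have hx₁ : x₁ ≤ x := le_trans (le_max_left _ _) hx
  have hx₂ : x₂ ≤ x := le_trans (le_trans (le_max_left _ _) (le_max_right _ _)) hx
  have hx₃ : x₃ ≤ x := le_trans (le_trans (le_max_right _ _) (le_max_right _ _)) hx
  have hR : zeroRepulsion (roughPoly f x (cutoff A x)) ≤ (C₀ : ℝ) / r₀ ^ 2 + (k : ℝ) * (Real.pi ^ 2 / 6) :=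
    latticeSum_holds k C₀ r₀ _ hr₀ hr₁ (hlat x hx₃)
  have hM : zeroRepulsion (eulerSpecies f (cutoff A x)) ≤ C₃ := hsp _
  have hN := hcpl x hx₂
  have hF := hfar x hx₁
  rw [zeroRepulsion_eq_nearPart_add_farPart f K x]
  linarith

/-- The five stub STATEMENTS imply the crux (explicit-hypotheses form of the composition; sorry-free). -/
theorem SystemZeroRepulsion_of_stubs (h₁ : LongCyclesLattice) (h₂ : FlowLinear) (h₃ : FibreUniversality)
    (h₅ : SpeciesCoupling) (h₆ : FarMomentWide) :
    Summit.Parity.BatemanHorn.Theses.AlmostPrimeZeros.SystemZeroRepulsion := by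
  intro k f hf
  obtain ⟨C, x₀, hC⟩ := eventually_bounded h₁ h₂ h₃ h₅ h₆ f hf
  obtain ⟨C', hC'⟩ := forall_le_of_eventually_le hC
  exact ⟨C', fun x _ => hC' x⟩

/-- **The line closes the crux** (concluded BY NAME, proof-of-item modulo the five registered stub sorries):
`SystemZeroRepulsion_of_stubs` fed with the registered stubs. -/
theorem SystemZeroRepulsion_of : Summit.Parity.BatemanHorn.Theses.AlmostPrimeZeros.SystemZeroRepulsion :=
  SystemZeroRepulsion_of_stubs longCyclesLattice_of_stub stub_flowLinear stub_fibreUniversality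
    stub_speciesCoupling farMomentWide_of_stub

end Summit.Parity.BatemanHorn.Cruxes.SystemZeroRepulsion.BuchstabFlowHyperbolicity

end
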